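import Summits.ResolutionOfSingularities.ResolutionOfSingularities.Theorems.FrobeniusLadderFInjectiveMacaulayficationTauFloorP2d5CYChartAlgebra
import Summits.ResolutionOfSingularities.ResolutionOfSingularities.Theorems.FrobeniusLadderFInjectiveMacaulayficationTauFloorF5YChartIdent
import Summits.ResolutionOfSingularities.ResolutionOfSingularities.Theorems.FrobeniusLadderFInjectiveMacaulayficationReesChartFacts
import Literature.AlgebraicGeometry.Resolution.AffineBlowupAlgebra
import HarnessLib

/-!
# (O-1′-Y′) The tower `T₂ = k[y, w, u′, t′, s′][x][z′]` IS the Rees chart `D(ȳ)` of `Bl_τ(P2d5C)`: chart map, blow-down map, injectivity,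
# `T₂ ≃+* blowupAlgebra τ ȳ`, and the CM clause at EVERY prime of `A₀[τ/ȳ]`
# (crux `FInjectiveMacaulayfication` stmt-ResolutionOfSingularities-15315, chain w45a; res-L1-w45a-plan-1 g19 RULING R19.15 «(O-1′) → stub-1»; sequel of
# `…TauFloorP2d5CYChartAlgebra`; method of res-L1-w45a-stub-2's p635410/p636759 one dimension up; seat res-L1-w45a-stub-1 g11)

[OURS · L1 W4.5a] Support file (`--supports stmt-ResolutionOfSingularities-15315 --as helper`); replaces the role of NO printed item; NOT a statement of any
manuscript; def-free; UNCONDITIONAL; characteristic-free (any field `k`). AI-written (AI review is weaker than expert review).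

SETTING. `A₀ = k[X0..X5]/(f)`, `f = X5² + X0⁴X5 + X1³ + X2³ + X3³ + X4³` (P2d5C: `x,y,u,t,s,z = X0..X5`), `τ = Ideal.span {x̄², ȳ, ū, t̄, s̄, z̄}`,
`T₂ = AdjoinRoot h₂` over `AdjoinRoot h₁` over `B₀ = MvPolynomial (Fin 5) k` (`y, w, u′, t′, s′ = X0..X4`), `h₁ = X² − C(yw)`, `h₂ = Z² + (C(yw²)Z + C(y(1+u′³+t′³+s′³)))`.
* §1 ring identities, `f_rel_away`, ★ `exists_chartMap` (`φ : T₂ → A₀[1/ȳ]`: `y, w, u′, t′, s′ ↦ ȳ, x̄²/ȳ, ū/ȳ, t̄/ȳ, s̄/ȳ`, `x̄ ↦ x̄`, `z̄′ ↦ z̄/ȳ`; by the universal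
  property `TauFloorP2d5CYChartAlgebra.exists_towerLift`), ★ `exists_blowdownMap` (`ψ₁ : A₀ → T₂`: `x̄, ȳ, ū, t̄, s̄, z̄ ↦ x̄, y, yu′, yt′, ys′, yz̄′`);
* §2 ★ `chartMap_injective` (`ȳ` is a non-zero-divisor of the flat `B₀`-algebra `T₂`);
* §3 ★★ `exists_chartEquiv : ∃ e : T₂ ≃+* blowupAlgebra τ ȳ` with the generator values; ★★ `cmCl_localization_blowupAlgebra` — CM at EVERY prime of `A₀[τ/ȳ]`.
[cite: GortzWedhorn2020, (13.19) p. 415] [cite: StacksProject, Tag 0804] [cite: Matsumura1987, Thm. 17.8, Thm. 23.3 (context)]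
-/

-- single-problem summit: the doubled namespace component is forced
set_option linter.dupNamespace false

noncomputable section

namespace Summit.ResolutionOfSingularities.ResolutionOfSingularities.Theorems.FInjectiveMacaulayfication.TauFloorP2d5CYChartIdent

open MvPolynomial IsLocalization Literature.AlgebraicGeometry.Resolution
open Summit.ResolutionOfSingularities.ResolutionOfSingularities.Theorems.FInjectiveMacaulayfication
open SliceableCentre TauFloorP2d5CYChartAlgebra

variable (k : Type) [Field k]

/-! ## §1 The chart map `φ : T₂ → A₀[1/ȳ]` and the blow-down map `ψ₁ : A₀ → T₂` -/

/-- `x² = y·(x²·i)` when `y·i = 1`. [ring identity] -/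
theorem ident_x {L : Type} [CommRing L] (x y i : L) (hyi : y * i = 1) : x ^ 2 = y * (x ^ 2 * i) := by
  linear_combination (-(x ^ 2)) * hyi

/-- `h₂(z·i) = 0` in `A₀[1/ȳ]`: `(zi)² + y(x²i)²(zi) + y(1 + (ui)³ + (Ti)³ + (si)³) = 0` when `z² + x⁴z + y³ + u³ + T³ + s³ = 0` and `y·i = 1`. [ring identity] -/
theorem ident_z {L : Type} [CommRing L] (x y u T s z i : L) (hF : z ^ 2 + x ^ 4 * z + y ^ 3 + u ^ 3 + T ^ 3 + s ^ 3 = 0) (hyi : y * i = 1) :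
    (z * i) ^ 2 + y * (x ^ 2 * i) ^ 2 * (z * i) + y * (1 + (u * i) ^ 3 + (T * i) ^ 3 + (s * i) ^ 3) = 0 := by
  linear_combination (i ^ 2) * hF + (x ^ 4 * z * i ^ 2 + (u ^ 3 + T ^ 3 + s ^ 3) * i ^ 2 - y * (y * i + 1)) * hyi

/-- `f(x, y, yu′, yt′, ys′, yz′) = y²·(z′² + y w² z′ + y(1+u′³+t′³+s′³))` modulo `x² = yw`. [ring identity] -/
theorem ident_blowdown {T : Type} [CommRing T] (x y w u t s z : T) (hx : x ^ 2 = y * w)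
    (hz : z ^ 2 = -(y * w ^ 2 * z + y * (1 + u ^ 3 + t ^ 3 + s ^ 3))) :
    (y * z) ^ 2 + x ^ 4 * (y * z) + y ^ 3 + (y * u) ^ 3 + (y * t) ^ 3 + (y * s) ^ 3 = 0 := by
  linear_combination (y ^ 2) * hz + (y * z * (x ^ 2 + y * w)) * hx

set_option synthInstance.maxHeartbeats 200000 in
-- `map_add`/`map_pow` rewriting over `k[X0..X5]/(f) → A₀[1/ȳ]` explores a slow (failing) `DistribMulAction` branch
/-- `f̄ = 0` read in `A₀[1/ȳ]`, expanded. [plumbing] -/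
theorem f_rel_away (f : MvPolynomial (Fin 6) k) (hf : f = X 5 ^ 2 + X 0 ^ 4 * X 5 + X 1 ^ 3 + X 2 ^ 3 + X 3 ^ 3 + X 4 ^ 3) :
    algebraMap (MvPolynomial (Fin 6) k ⧸ Ideal.span {f}) (Localization.Away (Ideal.Quotient.mk (Ideal.span {f}) (X 1) : MvPolynomial (Fin 6) k ⧸ Ideal.span {f})) (Ideal.Quotient.mk (Ideal.span {f}) (X 5)) ^ 2 +
      algebraMap (MvPolynomial (Fin 6) k ⧸ Ideal.span {f}) (Localization.Away (Ideal.Quotient.mk (Ideal.span {f}) (X 1) : MvPolynomial (Fin 6) k ⧸ Ideal.span {f})) (Ideal.Quotient.mk (Ideal.span {f}) (X 0)) ^ 4 *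
        algebraMap (MvPolynomial (Fin 6) k ⧸ Ideal.span {f}) (Localization.Away (Ideal.Quotient.mk (Ideal.span {f}) (X 1) : MvPolynomial (Fin 6) k ⧸ Ideal.span {f})) (Ideal.Quotient.mk (Ideal.span {f}) (X 5)) +
      algebraMap (MvPolynomial (Fin 6) k ⧸ Ideal.span {f}) (Localization.Away (Ideal.Quotient.mk (Ideal.span {f}) (X 1) : MvPolynomial (Fin 6) k ⧸ Ideal.span {f})) (Ideal.Quotient.mk (Ideal.span {f}) (X 1)) ^ 3 +
      algebraMap (MvPolynomial (Fin 6) k ⧸ Ideal.span {f}) (Localization.Away (Ideal.Quotient.mk (Ideal.span {f}) (X 1) : MvPolynomial (Fin 6) k ⧸ Ideal.span {f})) (Ideal.Quotient.mk (Ideal.span {f}) (X 2)) ^ 3 +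
      algebraMap (MvPolynomial (Fin 6) k ⧸ Ideal.span {f}) (Localization.Away (Ideal.Quotient.mk (Ideal.span {f}) (X 1) : MvPolynomial (Fin 6) k ⧸ Ideal.span {f})) (Ideal.Quotient.mk (Ideal.span {f}) (X 3)) ^ 3 +
      algebraMap (MvPolynomial (Fin 6) k ⧸ Ideal.span {f}) (Localization.Away (Ideal.Quotient.mk (Ideal.span {f}) (X 1) : MvPolynomial (Fin 6) k ⧸ Ideal.span {f})) (Ideal.Quotient.mk (Ideal.span {f}) (X 4)) ^ 3 = 0 := by
  have h0 : Ideal.Quotient.mk (Ideal.span {f}) (X 5 ^ 2 + X 0 ^ 4 * X 5 + X 1 ^ 3 + X 2 ^ 3 + X 3 ^ 3 + X 4 ^ 3 : MvPolynomial (Fin 6) k) = 0 := by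
    rw [← hf]; exact Ideal.Quotient.eq_zero_iff_mem.mpr (Ideal.mem_span_singleton_self f)
  have h1 := congrArg (algebraMap (MvPolynomial (Fin 6) k ⧸ Ideal.span {f}) (Localization.Away (Ideal.Quotient.mk (Ideal.span {f}) (X 1) : MvPolynomial (Fin 6) k ⧸ Ideal.span {f}))) h0
  rw [map_zero] at h1
  simpa only [map_add, map_mul, map_pow] using h1

/-- ★ **THE CHART MAP `φ : T₂ → A₀[1/ȳ]`** (`y, w, u′, t′, s′ ↦ ȳ, x̄²/ȳ, ū/ȳ, t̄/ȳ, s̄/ȳ`, `x̄ ↦ x̄`, `z̄′ ↦ z̄/ȳ`) exists — by the universal property of the tower.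
[cite: GortzWedhorn2020, (13.19) p. 415] -/
theorem exists_chartMap (f : MvPolynomial (Fin 6) k) (hf : f = X 5 ^ 2 + X 0 ^ 4 * X 5 + X 1 ^ 3 + X 2 ^ 3 + X 3 ^ 3 + X 4 ^ 3)
    (h₁ : Polynomial (MvPolynomial (Fin 5) k)) (hh₁ : h₁ = Polynomial.X ^ 2 - Polynomial.C (X 0 * X 1))
    (h₂ : Polynomial (AdjoinRoot h₁))
    (hh₂ : h₂ = Polynomial.X ^ 2 + (Polynomial.C (algebraMap (MvPolynomial (Fin 5) k) (AdjoinRoot h₁) (X 0 * X 1 ^ 2)) * Polynomial.X +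
      Polynomial.C (algebraMap (MvPolynomial (Fin 5) k) (AdjoinRoot h₁) (X 0 * (1 + X 2 ^ 3 + X 3 ^ 3 + X 4 ^ 3))))) :
    ∃ φ : AdjoinRoot h₂ →+* Localization.Away (Ideal.Quotient.mk (Ideal.span {f}) (X 1) : MvPolynomial (Fin 6) k ⧸ Ideal.span {f}),
      (∀ a : k, φ (algebraMap (MvPolynomial (Fin 5) k) (AdjoinRoot h₂) (C a)) = algebraMap (MvPolynomial (Fin 6) k ⧸ Ideal.span {f}) _ (Ideal.Quotient.mk (Ideal.span {f}) (C a))) ∧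
      (∀ i : Fin 5, φ (algebraMap (MvPolynomial (Fin 5) k) (AdjoinRoot h₂) (X i)) =
        ![algebraMap (MvPolynomial (Fin 6) k ⧸ Ideal.span {f}) _ (Ideal.Quotient.mk (Ideal.span {f}) (X 1)), algebraMap (MvPolynomial (Fin 6) k ⧸ Ideal.span {f}) _ (Ideal.Quotient.mk (Ideal.span {f}) (X 0)) ^ 2 * Away.invSelf (Ideal.Quotient.mk (Ideal.span {f}) (X 1)), algebraMap (MvPolynomial (Fin 6) k ⧸ Ideal.span {f}) _ (Ideal.Quotient.mk (Ideal.span {f}) (X 2)) * Away.invSelf (Ideal.Quotient.mk (Ideal.span {f}) (X 1)),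
          algebraMap (MvPolynomial (Fin 6) k ⧸ Ideal.span {f}) _ (Ideal.Quotient.mk (Ideal.span {f}) (X 3)) * Away.invSelf (Ideal.Quotient.mk (Ideal.span {f}) (X 1)), algebraMap (MvPolynomial (Fin 6) k ⧸ Ideal.span {f}) _ (Ideal.Quotient.mk (Ideal.span {f}) (X 4)) * Away.invSelf (Ideal.Quotient.mk (Ideal.span {f}) (X 1))] i) ∧
      φ (AdjoinRoot.of h₂ (AdjoinRoot.root h₁)) = algebraMap (MvPolynomial (Fin 6) k ⧸ Ideal.span {f}) _ (Ideal.Quotient.mk (Ideal.span {f}) (X 0)) ∧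
      φ (AdjoinRoot.root h₂) = algebraMap (MvPolynomial (Fin 6) k ⧸ Ideal.span {f}) _ (Ideal.Quotient.mk (Ideal.span {f}) (X 5)) * Away.invSelf (Ideal.Quotient.mk (Ideal.span {f}) (X 1)) := by
  classical
  let mkA : MvPolynomial (Fin 6) k →+* MvPolynomial (Fin 6) k ⧸ Ideal.span {f} := Ideal.Quotient.mk (Ideal.span {f})
  let L := Localization.Away (mkA (X 1))
  let ι : (MvPolynomial (Fin 6) k ⧸ Ideal.span {f}) →+* L := algebraMap _ _
  let inv : L := Away.invSelf (mkA (X 1))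
  have hyi : ι (mkA (X 1)) * inv = 1 := Away.mul_invSelf (S := L) (mkA (X 1))
  let v : Fin 5 → L := ![ι (mkA (X 1)), ι (mkA (X 0)) ^ 2 * inv, ι (mkA (X 2)) * inv, ι (mkA (X 3)) * inv, ι (mkA (X 4)) * inv]
  let g : MvPolynomial (Fin 5) k →+* L := eval₂Hom (ι.comp (mkA.comp MvPolynomial.C)) v
  have hgX : ∀ i, g (X i) = v i := fun i => eval₂Hom_X' _ _ i
  have hF := f_rel_away k f hf
  obtain ⟨φ, hφB, hφx, hφz⟩ : ∃ φ : AdjoinRoot h₂ →+* L, φ.comp (algebraMap (MvPolynomial (Fin 5) k) (AdjoinRoot h₂)) = g ∧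
      φ (AdjoinRoot.of h₂ (AdjoinRoot.root h₁)) = ι (mkA (X 0)) ∧ φ (AdjoinRoot.root h₂) = ι (mkA (X 5)) * inv := by
    refine exists_towerLift (S := L) k h₁ hh₁ h₂ hh₂ g (ι (mkA (X 0))) (ι (mkA (X 5)) * inv) ?_ ?_
    · rw [hgX, hgX]
      exact ident_x _ _ _ hyi
    · rw [hgX, hgX, hgX, hgX, hgX]
      exact ident_z _ _ _ _ _ _ _ hF hyi
  refine ⟨φ, fun a => ?_, fun i => ?_, hφx, hφz⟩
  · have h := RingHom.congr_fun hφB (C a)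
    rw [RingHom.comp_apply] at h
    rw [h]
    exact eval₂Hom_C _ _ a
  · have h := RingHom.congr_fun hφB (X i)
    rw [RingHom.comp_apply] at h
    rw [h, hgX]

/-- ★ **THE BLOW-DOWN MAP `ψ₁ : A₀ → T₂`** (`x̄, ȳ, ū, t̄, s̄, z̄ ↦ x̄, y, yu′, yt′, ys′, yz̄′`): it kills `f` by `ident_blowdown` and the two tower relations. [folklore] -/
theorem exists_blowdownMap (f : MvPolynomial (Fin 6) k) (hf : f = X 5 ^ 2 + X 0 ^ 4 * X 5 + X 1 ^ 3 + X 2 ^ 3 + X 3 ^ 3 + X 4 ^ 3)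
    (h₁ : Polynomial (MvPolynomial (Fin 5) k)) (hh₁ : h₁ = Polynomial.X ^ 2 - Polynomial.C (X 0 * X 1))
    (h₂ : Polynomial (AdjoinRoot h₁))
    (hh₂ : h₂ = Polynomial.X ^ 2 + (Polynomial.C (algebraMap (MvPolynomial (Fin 5) k) (AdjoinRoot h₁) (X 0 * X 1 ^ 2)) * Polynomial.X +
      Polynomial.C (algebraMap (MvPolynomial (Fin 5) k) (AdjoinRoot h₁) (X 0 * (1 + X 2 ^ 3 + X 3 ^ 3 + X 4 ^ 3))))) :
    ∃ ψ₁ : (MvPolynomial (Fin 6) k ⧸ Ideal.span {f}) →+* AdjoinRoot h₂,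
      (∀ j : Fin 6, ψ₁ (Ideal.Quotient.mk (Ideal.span {f}) (X j)) =
        ![AdjoinRoot.of h₂ (AdjoinRoot.root h₁), algebraMap (MvPolynomial (Fin 5) k) (AdjoinRoot h₂) (X 0), algebraMap (MvPolynomial (Fin 5) k) (AdjoinRoot h₂) (X 0) * algebraMap (MvPolynomial (Fin 5) k) (AdjoinRoot h₂) (X 2),
          algebraMap (MvPolynomial (Fin 5) k) (AdjoinRoot h₂) (X 0) * algebraMap (MvPolynomial (Fin 5) k) (AdjoinRoot h₂) (X 3), algebraMap (MvPolynomial (Fin 5) k) (AdjoinRoot h₂) (X 0) * algebraMap (MvPolynomial (Fin 5) k) (AdjoinRoot h₂) (X 4),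
          algebraMap (MvPolynomial (Fin 5) k) (AdjoinRoot h₂) (X 0) * AdjoinRoot.root h₂] j) ∧
      ∀ a : k, ψ₁ (Ideal.Quotient.mk (Ideal.span {f}) (C a)) = algebraMap (MvPolynomial (Fin 5) k) (AdjoinRoot h₂) (C a) := by
  let aM : MvPolynomial (Fin 5) k →+* AdjoinRoot h₂ := algebraMap (MvPolynomial (Fin 5) k) (AdjoinRoot h₂)
  let u : Fin 6 → AdjoinRoot h₂ := ![AdjoinRoot.of h₂ (AdjoinRoot.root h₁), aM (X 0), aM (X 0) * aM (X 2), aM (X 0) * aM (X 3), aM (X 0) * aM (X 4), aM (X 0) * AdjoinRoot.root h₂]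
  have hf0 : eval₂Hom (aM.comp MvPolynomial.C) u f = 0 := by
    rw [hf]
    simp only [map_add, map_mul, map_pow, eval₂Hom_X']
    exact ident_blowdown _ _ (aM (X 1)) _ _ _ _ (x_sq_eq k h₁ hh₁ h₂) (z_sq_eq k h₁ h₂ hh₂)
  refine ⟨Ideal.Quotient.lift (Ideal.span {f}) (eval₂Hom (aM.comp MvPolynomial.C) u) ?_, fun j => ?_, fun a => ?_⟩
  · intro a ha
    obtain ⟨c, rfl⟩ := Ideal.mem_span_singleton.mp ha
    rw [map_mul, hf0, zero_mul]
  · rw [Ideal.Quotient.lift_mk]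
    exact eval₂Hom_X' _ _ j
  · rw [Ideal.Quotient.lift_mk]
    exact eval₂Hom_C _ _ a

/-! ## §2 The chart map is injective -/

set_option maxHeartbeats 800000 in
-- one `IsLocalization` lift + a generator-by-generator comparison of two ring maps out of the tower
/-- ★ **The chart map `φ : T₂ → A₀[1/ȳ]` is injective**: with `ψ : A₀[1/ȳ] → T₂[1/y]` the extension of the blow-down map, `ψ ∘ φ = (T₂ → T₂[1/y])`
(checked on `k`, `y, w, u′, t′, s′`, `x̄`, `z̄′`), and `T₂ → T₂[1/y]` is injective since `y` is a non-zero-divisor of the FLAT `B₀`-algebra `T₂`. [folklore] -/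
theorem chartMap_injective (f : MvPolynomial (Fin 6) k) (hf : f = X 5 ^ 2 + X 0 ^ 4 * X 5 + X 1 ^ 3 + X 2 ^ 3 + X 3 ^ 3 + X 4 ^ 3)
    (h₁ : Polynomial (MvPolynomial (Fin 5) k)) (hh₁ : h₁ = Polynomial.X ^ 2 - Polynomial.C (X 0 * X 1))
    (h₂ : Polynomial (AdjoinRoot h₁))
    (hh₂ : h₂ = Polynomial.X ^ 2 + (Polynomial.C (algebraMap (MvPolynomial (Fin 5) k) (AdjoinRoot h₁) (X 0 * X 1 ^ 2)) * Polynomial.X +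
      Polynomial.C (algebraMap (MvPolynomial (Fin 5) k) (AdjoinRoot h₁) (X 0 * (1 + X 2 ^ 3 + X 3 ^ 3 + X 4 ^ 3)))))
    (φ : AdjoinRoot h₂ →+* Localization.Away (Ideal.Quotient.mk (Ideal.span {f}) (X 1) : MvPolynomial (Fin 6) k ⧸ Ideal.span {f}))
    (hφC : ∀ a : k, φ (algebraMap (MvPolynomial (Fin 5) k) (AdjoinRoot h₂) (C a)) = algebraMap (MvPolynomial (Fin 6) k ⧸ Ideal.span {f}) _ (Ideal.Quotient.mk (Ideal.span {f}) (C a)))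
    (hφX : ∀ i : Fin 5, φ (algebraMap (MvPolynomial (Fin 5) k) (AdjoinRoot h₂) (X i)) =
        ![algebraMap (MvPolynomial (Fin 6) k ⧸ Ideal.span {f}) _ (Ideal.Quotient.mk (Ideal.span {f}) (X 1)), algebraMap (MvPolynomial (Fin 6) k ⧸ Ideal.span {f}) _ (Ideal.Quotient.mk (Ideal.span {f}) (X 0)) ^ 2 * Away.invSelf (Ideal.Quotient.mk (Ideal.span {f}) (X 1)), algebraMap (MvPolynomial (Fin 6) k ⧸ Ideal.span {f}) _ (Ideal.Quotient.mk (Ideal.span {f}) (X 2)) * Away.invSelf (Ideal.Quotient.mk (Ideal.span {f}) (X 1)),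
          algebraMap (MvPolynomial (Fin 6) k ⧸ Ideal.span {f}) _ (Ideal.Quotient.mk (Ideal.span {f}) (X 3)) * Away.invSelf (Ideal.Quotient.mk (Ideal.span {f}) (X 1)), algebraMap (MvPolynomial (Fin 6) k ⧸ Ideal.span {f}) _ (Ideal.Quotient.mk (Ideal.span {f}) (X 4)) * Away.invSelf (Ideal.Quotient.mk (Ideal.span {f}) (X 1))] i)
    (hφx : φ (AdjoinRoot.of h₂ (AdjoinRoot.root h₁)) = algebraMap (MvPolynomial (Fin 6) k ⧸ Ideal.span {f}) _ (Ideal.Quotient.mk (Ideal.span {f}) (X 0)))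
    (hφz : φ (AdjoinRoot.root h₂) = algebraMap (MvPolynomial (Fin 6) k ⧸ Ideal.span {f}) _ (Ideal.Quotient.mk (Ideal.span {f}) (X 5)) * Away.invSelf (Ideal.Quotient.mk (Ideal.span {f}) (X 1))) :
    Function.Injective φ := by
  classical
  let mkA : MvPolynomial (Fin 6) k →+* MvPolynomial (Fin 6) k ⧸ Ideal.span {f} := Ideal.Quotient.mk (Ideal.span {f})
  let L := Localization.Away (mkA (X 1))
  let ι : (MvPolynomial (Fin 6) k ⧸ Ideal.span {f}) →+* L := algebraMap _ _
  let inv : L := Away.invSelf (mkA (X 1))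
  let aM : MvPolynomial (Fin 5) k →+* AdjoinRoot h₂ := algebraMap (MvPolynomial (Fin 5) k) (AdjoinRoot h₂)
  let yT : AdjoinRoot h₂ := aM (X 0)
  -- `y` is a non-zero-divisor of `T₂`, so `T₂ → T₂[1/y]` is injective
  have hy : yT ∈ nonZeroDivisors (AdjoinRoot h₂) := algebraMap_X0_mem_nonZeroDivisors k h₁ hh₁ h₂ hh₂
  let LT := Localization.Away yT
  let ιT : AdjoinRoot h₂ →+* LT := algebraMap _ _
  have hιT_inj : Function.Injective ιT :=
    IsLocalization.injective LT (M := Submonoid.powers yT) ((Submonoid.powers_le (P := nonZeroDivisors _)).mpr hy)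
  -- the blow-down map and its extension `ψ : A₀[1/ȳ] → T₂[1/y]`
  obtain ⟨ψ₁, hψX, hψC⟩ := exists_blowdownMap k f hf h₁ hh₁ h₂ hh₂
  have hψy : ψ₁ (mkA (X 1)) = yT := hψX 1
  have hunit : IsUnit ((ιT.comp ψ₁) (mkA (X 1))) := by
    rw [RingHom.comp_apply, hψy]
    exact IsLocalization.Away.algebraMap_isUnit yT
  let ψ : L →+* LT := IsLocalization.Away.lift (mkA (X 1)) hunit
  have hψι : ∀ a, ψ (ι a) = ιT (ψ₁ a) := fun a => IsLocalization.Away.lift_eq (mkA (X 1)) hunit a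
  have hψi : ψ inv * ιT yT = 1 := by
    have h1 : ψ inv * ψ (ι (mkA (X 1))) = 1 := by
      rw [← map_mul, mul_comm, Away.mul_invSelf, map_one]
    rwa [hψι, hψy] at h1
  -- generic cancellation: `ιT (y c) · ψ inv = ιT c`
  have hcan : ∀ c : AdjoinRoot h₂, ιT (yT * c) * ψ inv = ιT c := fun c => by
    rw [map_mul, mul_comm (ιT yT), mul_assoc, mul_comm (ιT yT), hψi, mul_one]
  -- `ψ ∘ φ = ιT`
  have hcomp : ψ.comp φ = ιT := by
    refine tower₂_ringHom_ext k h₁ h₂ (MvPolynomial.ringHom_ext (fun a => ?_) (fun i => ?_)) ?_ ?_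
    · change ψ (φ (aM (C a))) = ιT (aM (C a))
      rw [hφC, hψι, hψC]
    · change ψ (φ (aM (X i))) = ιT (aM (X i))
      rw [hφX]
      fin_cases i
      · change ψ (ι (mkA (X 1))) = ιT (aM (X 0))
        rw [hψι, hψy]
      · change ψ (ι (mkA (X 0)) ^ 2 * inv) = ιT (aM (X 1))
        rw [map_mul, map_pow, hψι, hψX 0]
        change ιT (AdjoinRoot.of h₂ (AdjoinRoot.root h₁)) ^ 2 * ψ inv = ιT (aM (X 1))
        rw [← map_pow ιT, x_sq_eq k h₁ hh₁ h₂]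
        exact hcan (aM (X 1))
      · change ψ (ι (mkA (X 2)) * inv) = ιT (aM (X 2))
        rw [map_mul, hψι, hψX 2]
        exact hcan (aM (X 2))
      · change ψ (ι (mkA (X 3)) * inv) = ιT (aM (X 3))
        rw [map_mul, hψι, hψX 3]
        exact hcan (aM (X 3))
      · change ψ (ι (mkA (X 4)) * inv) = ιT (aM (X 4))
        rw [map_mul, hψι, hψX 4]
        exact hcan (aM (X 4))
    · rw [RingHom.comp_apply, hφx, hψι, hψX 0]; rfl
    · rw [RingHom.comp_apply, hφz, map_mul, hψι, hψX 5]
      exact hcan (AdjoinRoot.root h₂)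
  have h2 : Function.Injective (⇑ψ ∘ ⇑φ) := by rw [← RingHom.coe_comp, hcomp]; exact hιT_inj
  exact h2.of_comp

/-! ## §3 ★★ `T₂ ≃ A₀[τ/ȳ]`, CM at every prime of `A₀[τ/ȳ]` -/

set_option synthInstance.maxHeartbeats 200000 in
set_option maxHeartbeats 1600000 in
-- generator bookkeeping on both sides (as in `TauFloorBXChartIdent.exists_chartEquiv`); `map_mul` rewriting explores a slow failing instance branch
/-- ★★ **The tower `T₂` is the Rees chart `D(ȳ)` of `Bl_τ X`**: a ring isomorphism `e : T₂ ≃+* blowupAlgebra τ ȳ` with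
`y, w, u′, t′, s′, x̄, z̄′ ↦ ȳ, x̄²/ȳ, ū/ȳ, t̄/ȳ, s̄/ȳ, x̄, z̄/ȳ` (values in `A₀[1/ȳ]`). [cite: GortzWedhorn2020, (13.19) p. 415] -/
theorem exists_chartEquiv (f : MvPolynomial (Fin 6) k) (hf : f = X 5 ^ 2 + X 0 ^ 4 * X 5 + X 1 ^ 3 + X 2 ^ 3 + X 3 ^ 3 + X 4 ^ 3)
    (h₁ : Polynomial (MvPolynomial (Fin 5) k)) (hh₁ : h₁ = Polynomial.X ^ 2 - Polynomial.C (X 0 * X 1))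
    (h₂ : Polynomial (AdjoinRoot h₁))
    (hh₂ : h₂ = Polynomial.X ^ 2 + (Polynomial.C (algebraMap (MvPolynomial (Fin 5) k) (AdjoinRoot h₁) (X 0 * X 1 ^ 2)) * Polynomial.X +
      Polynomial.C (algebraMap (MvPolynomial (Fin 5) k) (AdjoinRoot h₁) (X 0 * (1 + X 2 ^ 3 + X 3 ^ 3 + X 4 ^ 3))))) :
    ∃ e : AdjoinRoot h₂ ≃+* blowupAlgebra (Ideal.span {Ideal.Quotient.mk (Ideal.span {f}) (X 0) ^ 2, Ideal.Quotient.mk (Ideal.span {f}) (X 1), Ideal.Quotient.mk (Ideal.span {f}) (X 2), Ideal.Quotient.mk (Ideal.span {f}) (X 3), Ideal.Quotient.mk (Ideal.span {f}) (X 4), Ideal.Quotient.mk (Ideal.span {f}) (X 5)} : Ideal (MvPolynomial (Fin 6) k ⧸ Ideal.span {f})) (Ideal.Quotient.mk (Ideal.span {f}) (X 1)),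
      (∀ a : k, ((e (algebraMap (MvPolynomial (Fin 5) k) (AdjoinRoot h₂) (C a)) : blowupAlgebra _ (Ideal.Quotient.mk (Ideal.span {f}) (X 1))) : Localization.Away (Ideal.Quotient.mk (Ideal.span {f}) (X 1) : MvPolynomial (Fin 6) k ⧸ Ideal.span {f})) = algebraMap (MvPolynomial (Fin 6) k ⧸ Ideal.span {f}) _ (Ideal.Quotient.mk (Ideal.span {f}) (C a))) ∧
      (∀ i : Fin 5, ((e (algebraMap (MvPolynomial (Fin 5) k) (AdjoinRoot h₂) (X i)) : blowupAlgebra _ (Ideal.Quotient.mk (Ideal.span {f}) (X 1))) : Localization.Away (Ideal.Quotient.mk (Ideal.span {f}) (X 1) : MvPolynomial (Fin 6) k ⧸ Ideal.span {f})) =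
        ![algebraMap (MvPolynomial (Fin 6) k ⧸ Ideal.span {f}) _ (Ideal.Quotient.mk (Ideal.span {f}) (X 1)), algebraMap (MvPolynomial (Fin 6) k ⧸ Ideal.span {f}) _ (Ideal.Quotient.mk (Ideal.span {f}) (X 0)) ^ 2 * Away.invSelf (Ideal.Quotient.mk (Ideal.span {f}) (X 1)), algebraMap (MvPolynomial (Fin 6) k ⧸ Ideal.span {f}) _ (Ideal.Quotient.mk (Ideal.span {f}) (X 2)) * Away.invSelf (Ideal.Quotient.mk (Ideal.span {f}) (X 1)),
          algebraMap (MvPolynomial (Fin 6) k ⧸ Ideal.span {f}) _ (Ideal.Quotient.mk (Ideal.span {f}) (X 3)) * Away.invSelf (Ideal.Quotient.mk (Ideal.span {f}) (X 1)), algebraMap (MvPolynomial (Fin 6) k ⧸ Ideal.span {f}) _ (Ideal.Quotient.mk (Ideal.span {f}) (X 4)) * Away.invSelf (Ideal.Quotient.mk (Ideal.span {f}) (X 1))] i) ∧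
      ((e (AdjoinRoot.of h₂ (AdjoinRoot.root h₁)) : blowupAlgebra _ (Ideal.Quotient.mk (Ideal.span {f}) (X 1))) : Localization.Away (Ideal.Quotient.mk (Ideal.span {f}) (X 1) : MvPolynomial (Fin 6) k ⧸ Ideal.span {f})) = algebraMap (MvPolynomial (Fin 6) k ⧸ Ideal.span {f}) _ (Ideal.Quotient.mk (Ideal.span {f}) (X 0)) ∧
      ((e (AdjoinRoot.root h₂) : blowupAlgebra _ (Ideal.Quotient.mk (Ideal.span {f}) (X 1))) : Localization.Away (Ideal.Quotient.mk (Ideal.span {f}) (X 1) : MvPolynomial (Fin 6) k ⧸ Ideal.span {f})) = algebraMap (MvPolynomial (Fin 6) k ⧸ Ideal.span {f}) _ (Ideal.Quotient.mk (Ideal.span {f}) (X 5)) * Away.invSelf (Ideal.Quotient.mk (Ideal.span {f}) (X 1)) := by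
  classical
  obtain ⟨φ, hφC, hφX, hφx, hφz⟩ := exists_chartMap k f hf h₁ hh₁ h₂ hh₂
  have hinj := chartMap_injective k f hf h₁ hh₁ h₂ hh₂ φ hφC hφX hφx hφz
  obtain ⟨ψ₁, hψX, hψC⟩ := exists_blowdownMap k f hf h₁ hh₁ h₂ hh₂
  -- abbreviations (terms only)
  let mkA : MvPolynomial (Fin 6) k →+* MvPolynomial (Fin 6) k ⧸ Ideal.span {f} := Ideal.Quotient.mk (Ideal.span {f})
  let τ : Ideal (MvPolynomial (Fin 6) k ⧸ Ideal.span {f}) := Ideal.span {mkA (X 0) ^ 2, mkA (X 1), mkA (X 2), mkA (X 3), mkA (X 4), mkA (X 5)}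
  let L := Localization.Away (mkA (X 1))
  let B : Subalgebra (MvPolynomial (Fin 6) k ⧸ Ideal.span {f}) L := blowupAlgebra τ (mkA (X 1))
  let ι : (MvPolynomial (Fin 6) k ⧸ Ideal.span {f}) →+* L := algebraMap _ _
  let inv : L := Away.invSelf (mkA (X 1))
  let aM : MvPolynomial (Fin 5) k →+* AdjoinRoot h₂ := algebraMap (MvPolynomial (Fin 5) k) (AdjoinRoot h₂)
  have hyi : ι (mkA (X 1)) * inv = 1 := Away.mul_invSelf (S := L) (mkA (X 1))
  have hcan : ∀ j : Fin 6, ι (mkA (X 1)) * (ι (mkA (X j)) * inv) = ι (mkA (X j)) := fun j => by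
    rw [mul_comm, mul_assoc, mul_comm inv, hyi, mul_one]
  -- (1) `φ ∘ ψ₁ = ι`
  have hφψ : φ.comp ψ₁ = ι := by
    refine Ideal.Quotient.ringHom_ext (MvPolynomial.ringHom_ext (fun a => ?_) (fun j => ?_))
    · change φ (ψ₁ (mkA (C a))) = ι (mkA (C a))
      rw [hψC, hφC]
    · change φ (ψ₁ (mkA (X j))) = ι (mkA (X j))
      rw [hψX]
      fin_cases j
      · exact hφx
      · exact hφX 0
      · change φ (aM (X 0) * aM (X 2)) = ι (mkA (X 2))
        rw [map_mul, hφX 0, hφX 2]; exact hcan 2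
      · change φ (aM (X 0) * aM (X 3)) = ι (mkA (X 3))
        rw [map_mul, hφX 0, hφX 3]; exact hcan 3
      · change φ (aM (X 0) * aM (X 4)) = ι (mkA (X 4))
        rw [map_mul, hφX 0, hφX 4]; exact hcan 4
      · change φ (aM (X 0) * AdjoinRoot.root h₂) = ι (mkA (X 5))
        rw [map_mul, hφX 0, hφz]; exact hcan 5
  have hι_mem : ∀ a, ι a ∈ φ.range := fun a => ⟨ψ₁ a, by rw [← RingHom.comp_apply, hφψ]⟩
  -- (2) `range φ ⊆ B`: every generator of the tower lands in `B`
  have hB₀ : ∀ b : MvPolynomial (Fin 5) k, φ (aM b) ∈ B := by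
    intro b
    induction b using MvPolynomial.induction_on with
    | C a => rw [hφC]; exact B.algebraMap_mem _
    | add p q hp hq => rw [map_add, map_add]; exact B.add_mem hp hq
    | mul_X p i hp =>
      rw [map_mul, map_mul]
      refine B.mul_mem hp ?_
      rw [hφX]
      fin_cases i
      · exact B.algebraMap_mem (mkA (X 1))
      · change ι (mkA (X 0)) ^ 2 * inv ∈ B
        rw [← map_pow ι]
        exact div_mem_blowupAlgebra τ (mkA (X 1)) (Ideal.subset_span (by simp))
      · change ι (mkA (X 2)) * inv ∈ B
        exact div_mem_blowupAlgebra τ (mkA (X 1)) (Ideal.subset_span (by simp))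
      · change ι (mkA (X 3)) * inv ∈ B
        exact div_mem_blowupAlgebra τ (mkA (X 1)) (Ideal.subset_span (by simp))
      · change ι (mkA (X 4)) * inv ∈ B
        exact div_mem_blowupAlgebra τ (mkA (X 1)) (Ideal.subset_span (by simp))
  have hrange_le : ∀ c, φ c ∈ B := by
    -- level 1, level 2 via `adjoinRoot_subring_eq_top`
    have l1 : ∀ x : AdjoinRoot h₁, (φ.comp (AdjoinRoot.of h₂)) x ∈ B := by
      refine TauFloorF5YChartIdent.adjoinRoot_subring_eq_top h₁ (B.toSubring.comap (φ.comp (AdjoinRoot.of h₂))) (fun b => ?_) ?_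
      · change φ (AdjoinRoot.of h₂ (AdjoinRoot.of h₁ b)) ∈ B
        rw [← algebraMap_tower_apply]; exact hB₀ b
      · change φ (AdjoinRoot.of h₂ (AdjoinRoot.root h₁)) ∈ B
        rw [hφx]; exact B.algebraMap_mem _
    refine TauFloorF5YChartIdent.adjoinRoot_subring_eq_top h₂ (B.toSubring.comap φ) (fun b => l1 b) ?_
    change φ (AdjoinRoot.root h₂) ∈ B
    rw [hφz]
    change ι (mkA (X 5)) * inv ∈ B
    exact div_mem_blowupAlgebra τ (mkA (X 1)) (Ideal.subset_span (by simp))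
  -- (3) `B ⊆ range φ`: the range is an `A₀`-subalgebra containing the generators `g/ȳ`, `g ∈ τ`
  let Rφ : Subalgebra (MvPolynomial (Fin 6) k ⧸ Ideal.span {f}) L :=
    { carrier := φ.range
      mul_mem' := fun ha hb => φ.range.mul_mem ha hb
      one_mem' := φ.range.one_mem
      add_mem' := fun ha hb => φ.range.add_mem ha hb
      zero_mem' := φ.range.zero_mem
      algebraMap_mem' := fun a => hι_mem a }
  have hgens : blowupAlgebraGens τ (mkA (X 1)) ⊆ (Rφ : Set L) := by
    rintro _ ⟨g, hg, rfl⟩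
    change ι g * inv ∈ φ.range
    refine Submodule.span_induction (p := fun g _ => ι g * inv ∈ φ.range) ?_ ?_ ?_ ?_ hg
    · intro g hg
      simp only [Set.mem_insert_iff, Set.mem_singleton_iff] at hg
      rcases hg with rfl | rfl | rfl | rfl | rfl | rfl
      · exact ⟨aM (X 1), by rw [hφX 1, map_pow ι]; rfl⟩
      · exact ⟨1, by rw [map_one, hyi]⟩
      · exact ⟨aM (X 2), hφX 2⟩
      · exact ⟨aM (X 3), hφX 3⟩
      · exact ⟨aM (X 4), hφX 4⟩
      · exact ⟨AdjoinRoot.root h₂, hφz⟩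
    · rw [map_zero, zero_mul]; exact φ.range.zero_mem
    · intro a b _ _ ha hb
      rw [map_add, add_mul]; exact φ.range.add_mem ha hb
    · intro r a _ ha
      rw [smul_eq_mul, map_mul, mul_assoc]; exact φ.range.mul_mem (hι_mem r) ha
  have hle_range : B ≤ Rφ := Algebra.adjoin_le hgens
  -- (4) the equivalence
  have hsurj : Function.Surjective (φ.codRestrict B.toSubring fun c => hrange_le c) := by
    intro b
    obtain ⟨c, hc⟩ := (hle_range b.2 : (b : L) ∈ φ.range)
    exact ⟨c, Subtype.ext hc⟩
  have hinj' : Function.Injective (φ.codRestrict B.toSubring fun c => hrange_le c) := fun a b h =>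
    hinj (congrArg Subtype.val h)
  exact ⟨RingEquiv.ofBijective (φ.codRestrict B.toSubring fun c => hrange_le c) ⟨hinj', hsurj⟩, hφC, hφX, hφx, hφz⟩

/-- ★★ **CM at every prime of `A₀[τ/ȳ]`** — the free finite `B₀`-algebra `T₂` is CM at every prime (`TauFloorP2d5CYChartAlgebra.cmCl_localization`), transported
along `T₂ ≃+* blowupAlgebra τ ȳ`. [cite: Matsumura1987, Thm. 17.8, Thm. 23.3 (context)] -/
theorem cmCl_localization_blowupAlgebra (f : MvPolynomial (Fin 6) k) (hf : f = X 5 ^ 2 + X 0 ^ 4 * X 5 + X 1 ^ 3 + X 2 ^ 3 + X 3 ^ 3 + X 4 ^ 3)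
    (Q : Ideal (blowupAlgebra (Ideal.span {Ideal.Quotient.mk (Ideal.span {f}) (X 0) ^ 2, Ideal.Quotient.mk (Ideal.span {f}) (X 1), Ideal.Quotient.mk (Ideal.span {f}) (X 2), Ideal.Quotient.mk (Ideal.span {f}) (X 3), Ideal.Quotient.mk (Ideal.span {f}) (X 4), Ideal.Quotient.mk (Ideal.span {f}) (X 5)} :
      Ideal (MvPolynomial (Fin 6) k ⧸ Ideal.span {f})) (Ideal.Quotient.mk (Ideal.span {f}) (X 1)))) [Q.IsPrime] :
    CMCl (Localization.AtPrime Q) := by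
  let h₁ : Polynomial (MvPolynomial (Fin 5) k) := Polynomial.X ^ 2 - Polynomial.C (X 0 * X 1)
  let h₂ : Polynomial (AdjoinRoot h₁) := Polynomial.X ^ 2 + (Polynomial.C (algebraMap (MvPolynomial (Fin 5) k) (AdjoinRoot h₁) (X 0 * X 1 ^ 2)) * Polynomial.X +
      Polynomial.C (algebraMap (MvPolynomial (Fin 5) k) (AdjoinRoot h₁) (X 0 * (1 + X 2 ^ 3 + X 3 ^ 3 + X 4 ^ 3))))
  obtain ⟨e, -⟩ := exists_chartEquiv k f hf h₁ rfl h₂ rfl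
  exact ReesChartFacts.transport_cmCl e (fun P _ => cmCl_localization k h₁ rfl h₂ rfl P) Q

end Summit.ResolutionOfSingularities.ResolutionOfSingularities.Theorems.FInjectiveMacaulayfication.TauFloorP2d5CYChartIdent

end
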